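import Summits.CriticalPhenomena.SAWScalingLimit.Theorems.SAWDefectDecoherencePickHalfPlaneDefs
import Summits.CriticalPhenomena.SAWScalingLimit.Theorems.SAWDefectDecoherenceDecoherenceSynthesis
import HarnessLib

/-!
# A discrete Poincaré inequality on lattice boxes, and the `L¹`-oscillation of developing maps
(crux `BoundaryClosureR`, stmt-CriticalPhenomena-14004, line `pick-half-plane`, engine input S3;
registered sub-goal `pickEngine_poincare`)

GENERIC (any seminormed additive group `E`, `u : ℕ → ℕ → E` on the box `range N₀ × range N₁`):
`Σ_{s ∈ B} Σ_{s' ∈ B} ‖u s − u s'‖ ≤ #B · (N₀ · Σ_{row steps} ‖Δ₀ u‖ + N₁ · Σ_{column steps} ‖Δ₁ u‖)`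
(`box_poincare_pairs`): join `s' = (i',j')` to `s = (i,j)` along the row `j'` and then the column
`i`; the path stays in the box, the increment along it is bounded by the FULL row sum of row `j'`
plus the FULL column sum of column `i` (telescoping, `norm_sub_le_sum_line`), and summing over the
`#B²` pairs counts every row sum `#B · N₀` times and every column sum `#B · N₁` times.  Mean form
(`box_poincare_mean`, `E` a real normed space): `Σ_{s ∈ B} ‖u s − mean_B u‖ ≤ N₀ Σ_rows + N₁ Σ_cols`.

LATTICE (`potential_box_poincare`, registered as `pickEngine_poincare`): for a potential `H` of
`F dz` (`IsPotential Λ a H`, `F = F(a, ·, x_c, 5/8)`) and a box of INTERIOR sites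
`![x₀ + i, y₀ + j]`, `i < N₀`, `j < N₁`, the `e₀`-steps of `H` are the rotated edge values
`edgeValue F s 5` and the `e₁`-steps are `edgeValue F s 0` (`potential_spoke`, spokes `5` and `0`),
so `Σ_{s,s' ∈ B} ‖H s − H s'‖ ≤ 2 · #B · max N₀ N₁ · Σ_{s ∈ B} (‖edgeValue F s 5‖ + ‖edgeValue F s 0‖)`,
with `‖edgeValue F s k‖ = ‖F(edge_k)‖ / (2√3)` (`norm_edgeValue`: the half-edge vector has length
`1/(2√3)`).  With `δ`-scaling this bounds the `L¹`-oscillation of the normalised developing map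
`h_δ = δ H / F(b δ)` on a box by `(diam B) · δ² Σ_{e near B} ‖F(e)‖/‖F(b δ)‖`, i.e. by the local
`L¹` law `LocalL1Bound` — the compactness-modulo-constants half of the engine's input S3.
-/

noncomputable section

open scoped BigOperators
open Finset
open Literature.Probability.LatticeModels Literature.Probability.RandomPlanarGeometry
open Literature.Probability.RandomPlanarGeometry.SAW
open Literature.Barriers.CriticalPhenomena
open Summit.CriticalPhenomena.SAWScalingLimit.Cruxes.DefectDecoherence.TipMartingaleDepthInduction.WallExitTwoPoint
  (normSq_hexCenter_sub_of_adj)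

namespace Summit.CriticalPhenomena.SAWScalingLimit.Theorems.PickHalfPlane.LocalL1

/-! ### 1. The generic discrete Poincaré inequality on a box -/

section Generic

variable {E : Type*} [SeminormedAddCommGroup E]

/-- **Telescoping on a lattice line**: for `i, i' < N`, `‖f i − f i'‖` is at most the sum of the
`N − 1` step norms `‖f (k+1) − f k‖`, `k < N − 1`. -/
theorem norm_sub_le_sum_line (f : ℕ → E) {N i i' : ℕ} (hi : i < N) (hi' : i' < N) :
    ‖f i - f i'‖ ≤ ∑ k ∈ range (N - 1), ‖f (k + 1) - f k‖ := by
  have key : ∀ m n, m ≤ n → n < N → ‖f m - f n‖ ≤ ∑ k ∈ range (N - 1), ‖f (k + 1) - f k‖ := by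
    intro m n hmn hn
    rw [← dist_eq_norm]
    refine (dist_le_Ico_sum_dist f hmn).trans ?_
    refine (sum_le_sum_of_subset_of_nonneg (fun k hk => ?_) fun _ _ _ => dist_nonneg).trans
      (le_of_eq (sum_congr rfl fun k _ => by rw [dist_eq_norm, norm_sub_rev]))
    rw [mem_Ico] at hk
    rw [mem_range]
    omega
  rcases le_total i i' with h | h
  · exact key i i' h hi'
  · rw [norm_sub_rev]; exact key i' i h hi

/-- **Discrete Poincaré inequality on a box (pair form).**  For `u` on the box
`range N₀ × range N₁` (`#B = N₀ N₁`):
`Σ_{s ∈ B} Σ_{s' ∈ B} ‖u s − u s'‖ ≤ #B · (N₀ · Σ_{rows} Σ_{row steps} ‖Δ₀ u‖ + N₁ · Σ_{columns} Σ_{column steps} ‖Δ₁ u‖)`. -/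
theorem box_poincare_pairs (u : ℕ → ℕ → E) (N₀ N₁ : ℕ) :
    ∑ i ∈ range N₀, ∑ j ∈ range N₁, ∑ i' ∈ range N₀, ∑ j' ∈ range N₁, ‖u i j - u i' j'‖ ≤
      ((N₀ * N₁ : ℕ) : ℝ) *
        (N₀ * ∑ j ∈ range N₁, ∑ i ∈ range (N₀ - 1), ‖u (i + 1) j - u i j‖ +
          N₁ * ∑ i ∈ range N₀, ∑ j ∈ range (N₁ - 1), ‖u i (j + 1) - u i j‖) := by
  set R : ℕ → ℝ := fun j => ∑ i ∈ range (N₀ - 1), ‖u (i + 1) j - u i j‖ with hR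
  set C : ℕ → ℝ := fun i => ∑ j ∈ range (N₁ - 1), ‖u i (j + 1) - u i j‖ with hC
  have hpair : ∀ i ∈ range N₀, ∀ j ∈ range N₁, ∀ i' ∈ range N₀, ∀ j' ∈ range N₁,
      ‖u i j - u i' j'‖ ≤ C i + R j' := by
    intro i hi j hj i' hi' j' hj'
    rw [mem_range] at hi hj hi' hj'
    calc ‖u i j - u i' j'‖ ≤ ‖u i j - u i j'‖ + ‖u i j' - u i' j'‖ :=
          norm_sub_le_norm_sub_add_norm_sub _ _ _
      _ ≤ C i + R j' :=
          add_le_add (norm_sub_le_sum_line (fun k => u i k) hj hj')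
            (norm_sub_le_sum_line (fun k => u k j') hi hi')
  calc ∑ i ∈ range N₀, ∑ j ∈ range N₁, ∑ i' ∈ range N₀, ∑ j' ∈ range N₁, ‖u i j - u i' j'‖
      ≤ ∑ i ∈ range N₀, ∑ j ∈ range N₁, ∑ i' ∈ range N₀, ∑ j' ∈ range N₁, (C i + R j') :=
        sum_le_sum fun i hi => sum_le_sum fun j hj => sum_le_sum fun i' hi' =>
          sum_le_sum fun j' hj' => hpair i hi j hj i' hi' j' hj'
    _ = ((N₀ * N₁ : ℕ) : ℝ) * (N₀ * ∑ j ∈ range N₁, R j + N₁ * ∑ i ∈ range N₀, C i) := by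
        simp only [sum_add_distrib, sum_const, card_range, nsmul_eq_mul, ← mul_sum]
        push_cast
        ring

/-- **Discrete Poincaré inequality on a box (mean form)**, `E` a real normed space:
`Σ_{s ∈ B} ‖u s − (#B)⁻¹ Σ_{s' ∈ B} u s'‖ ≤ N₀ · Σ_{rows} Σ ‖Δ₀ u‖ + N₁ · Σ_{columns} Σ ‖Δ₁ u‖`. -/
theorem box_poincare_mean {E : Type*} [NormedAddCommGroup E] [NormedSpace ℝ E]
    (u : ℕ → ℕ → E) (N₀ N₁ : ℕ) :
    ∑ i ∈ range N₀, ∑ j ∈ range N₁,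
        ‖u i j - (((N₀ * N₁ : ℕ) : ℝ))⁻¹ • ∑ i' ∈ range N₀, ∑ j' ∈ range N₁, u i' j'‖ ≤
      N₀ * ∑ j ∈ range N₁, ∑ i ∈ range (N₀ - 1), ‖u (i + 1) j - u i j‖ +
        N₁ * ∑ i ∈ range N₀, ∑ j ∈ range (N₁ - 1), ‖u i (j + 1) - u i j‖ := by
  have hRHS : 0 ≤ (N₀ : ℝ) * ∑ j ∈ range N₁, ∑ i ∈ range (N₀ - 1), ‖u (i + 1) j - u i j‖ +
      N₁ * ∑ i ∈ range N₀, ∑ j ∈ range (N₁ - 1), ‖u i (j + 1) - u i j‖ := by positivity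
  by_cases h0 : (N₀ * N₁ : ℕ) = 0
  · rcases Nat.mul_eq_zero.1 h0 with h | h
    · subst h; simp
    · subst h; simp
  have hc : (((N₀ * N₁ : ℕ) : ℝ)) ≠ 0 := by exact_mod_cast h0
  have hcpos : 0 < (((N₀ * N₁ : ℕ) : ℝ)) := by positivity
  set m : E := (((N₀ * N₁ : ℕ) : ℝ))⁻¹ • ∑ i' ∈ range N₀, ∑ j' ∈ range N₁, u i' j' with hm
  -- each deviation from the mean is the average of the pair differences
  have hdev : ∀ i j, u i j - m =
      (((N₀ * N₁ : ℕ) : ℝ))⁻¹ • ∑ i' ∈ range N₀, ∑ j' ∈ range N₁, (u i j - u i' j') := by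
    intro i j
    have hconst : ∑ _i' ∈ range N₀, ∑ _j' ∈ range N₁, u i j = (((N₀ * N₁ : ℕ) : ℝ)) • u i j := by
      rw [sum_const, sum_const, card_range, card_range, ← mul_smul, Nat.cast_smul_eq_nsmul]
    simp only [sum_sub_distrib]
    rw [hconst, smul_sub, inv_smul_smul₀ hc]
  calc ∑ i ∈ range N₀, ∑ j ∈ range N₁, ‖u i j - m‖
      ≤ ∑ i ∈ range N₀, ∑ j ∈ range N₁,
          ((((N₀ * N₁ : ℕ) : ℝ))⁻¹ * ∑ i' ∈ range N₀, ∑ j' ∈ range N₁, ‖u i j - u i' j'‖) := by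
        refine sum_le_sum fun i _ => sum_le_sum fun j _ => ?_
        rw [hdev i j, norm_smul, norm_inv, Real.norm_of_nonneg hcpos.le]
        exact mul_le_mul_of_nonneg_left
          ((norm_sum_le _ _).trans (sum_le_sum fun i' _ => norm_sum_le _ _)) (inv_nonneg.2 hcpos.le)
    _ = (((N₀ * N₁ : ℕ) : ℝ))⁻¹ *
          ∑ i ∈ range N₀, ∑ j ∈ range N₁, ∑ i' ∈ range N₀, ∑ j' ∈ range N₁, ‖u i j - u i' j'‖ := by
        rw [mul_sum]
        exact sum_congr rfl fun i _ => (mul_sum _ _ _).symm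
    _ ≤ (((N₀ * N₁ : ℕ) : ℝ))⁻¹ * ((((N₀ * N₁ : ℕ) : ℝ)) *
          (N₀ * ∑ j ∈ range N₁, ∑ i ∈ range (N₀ - 1), ‖u (i + 1) j - u i j‖ +
            N₁ * ∑ i ∈ range N₀, ∑ j ∈ range (N₁ - 1), ‖u i (j + 1) - u i j‖)) :=
        mul_le_mul_of_nonneg_left (box_poincare_pairs u N₀ N₁) (inv_nonneg.2 hcpos.le)
    _ = _ := by rw [← mul_assoc, inv_mul_cancel₀ hc, one_mul]

end Generic

/-! ### 2. Potentials on boxes of interior sites -/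

/-- **The half-edge vector of a rotated edge value has length `1/(2√3)`**:
`‖edgeValue F s k‖ = ‖F(edge_k)‖ / (2√3)`. -/
theorem norm_edgeValue (F : Sym2 HexVertex → ℂ) (s : Site 2) (k : Fin 6) :
    ‖edgeValue F s k‖ = ‖F (HexKernel.edge s k)‖ / (2 * Real.sqrt 3) := by
  have hadj : hexGraph.Adj (HexKernel.face s (k + 1)) (HexKernel.face s k) :=
    (HexKernel.adj_face_iff HexKernel.hexGraph_adj_iff_of_snd_eq_zero_holds
      HexKernel.not_hexGraph_adj_of_snd_eq_holds s k _).2 (Or.inl rfl)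
  have hswap : HexKernel.edge s k = s(HexKernel.face s (k + 1), HexKernel.face s k) := by
    rw [HexKernel.edge, Sym2.eq_swap]
  have h3 : (0 : ℝ) < Real.sqrt 3 := Real.sqrt_pos.2 (by norm_num)
  have hcc : ‖hexCenter (HexKernel.face s k) - hexCenter (HexKernel.face s (k + 1))‖ =
      (Real.sqrt 3)⁻¹ := by
    rw [← Real.sqrt_sq (norm_nonneg _), Complex.sq_norm, normSq_hexCenter_sub_of_adj hadj, one_div,
      Real.sqrt_inv]
  have hvec : ‖hexMidpoint (HexKernel.edge s k) - hexCenter (HexKernel.face s (k + 1))‖ =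
      1 / (2 * Real.sqrt 3) := by
    rw [hswap, DecoherenceSynthesis.hexMidpoint_sub_hexCenter, norm_div, Complex.norm_two, hcc]
    field_simp
  rw [edgeValue, norm_mul, hvec]
  field_simp

/-- The `e₀`-step of the box parametrisation is the spoke `5`. -/
theorem site_succ_fst (x₀ y₀ : ℤ) (i j : ℕ) :
    (![x₀ + ((i + 1 : ℕ) : ℤ), y₀ + (j : ℤ)] : Site 2) = spoke ![x₀ + (i : ℤ), y₀ + (j : ℤ)] 5 := by
  ext k
  fin_cases k
  · simp [spoke, Matrix.vecHead, Matrix.vecTail]; ring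
  · simp [spoke, Matrix.vecHead, Matrix.vecTail]

/-- The `e₁`-step of the box parametrisation is the spoke `0`. -/
theorem site_succ_snd (x₀ y₀ : ℤ) (i j : ℕ) :
    (![x₀ + (i : ℤ), y₀ + ((j + 1 : ℕ) : ℤ)] : Site 2) = spoke ![x₀ + (i : ℤ), y₀ + (j : ℤ)] 0 := by
  ext k
  fin_cases k
  · simp [spoke, Matrix.vecHead, Matrix.vecTail]
  · simp [spoke, Matrix.vecHead, Matrix.vecTail]; ring

/-- **Discrete Poincaré inequality for a potential on a box of interior sites.**  For a potential
`H` of `F dz` (`F = F(a, ·, x_c, 5/8)`) and the box of sites `![x₀ + i, y₀ + j]`, `i < N₀`, `j < N₁`,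
all interior for `Λ`:
`Σ_{s ∈ B} Σ_{s' ∈ B} ‖H s − H s'‖ ≤ 2 · #B · max N₀ N₁ · Σ_{s ∈ B} (‖edgeValue F s 5‖ + ‖edgeValue F s 0‖)`
(the `e₀`- and `e₁`-steps of `H` inside the box are the rotated edge values `5` and `0`,
`potential_spoke`; then `box_poincare_pairs`). -/
theorem potential_box_poincare {Λ : Finset HexVertex} {a : Sym2 HexVertex} {H : Site 2 → ℂ}
    (hH : IsPotential Λ a H) (x₀ y₀ : ℤ) (N₀ N₁ : ℕ)
    (hint : ∀ i j : ℕ, i < N₀ → j < N₁ → IsInteriorSite Λ ![x₀ + (i : ℤ), y₀ + (j : ℤ)]) :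
    ∑ i ∈ range N₀, ∑ j ∈ range N₁, ∑ i' ∈ range N₀, ∑ j' ∈ range N₁,
        ‖H ![x₀ + (i : ℤ), y₀ + (j : ℤ)] - H ![x₀ + (i' : ℤ), y₀ + (j' : ℤ)]‖ ≤
      2 * ((N₀ * N₁ : ℕ) : ℝ) * ((max N₀ N₁ : ℕ) : ℝ) *
        ∑ i ∈ range N₀, ∑ j ∈ range N₁,
          (‖edgeValue (hexParafermionicObservable Λ a hexCriticalFugacity (5 / 8))
              ![x₀ + (i : ℤ), y₀ + (j : ℤ)] 5‖ +
            ‖edgeValue (hexParafermionicObservable Λ a hexCriticalFugacity (5 / 8))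
              ![x₀ + (i : ℤ), y₀ + (j : ℤ)] 0‖) := by
  set F := hexParafermionicObservable Λ a hexCriticalFugacity (5 / 8) with hF
  set u : ℕ → ℕ → ℂ := fun i j => H ![x₀ + (i : ℤ), y₀ + (j : ℤ)] with hu
  set A : ℕ → ℕ → ℝ := fun i j => ‖edgeValue F ![x₀ + (i : ℤ), y₀ + (j : ℤ)] 5‖ with hA
  set Bv : ℕ → ℕ → ℝ := fun i j => ‖edgeValue F ![x₀ + (i : ℤ), y₀ + (j : ℤ)] 0‖ with hB
  have hA0 : ∀ i j, 0 ≤ A i j := fun i j => norm_nonneg _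
  have hB0 : ∀ i j, 0 ≤ Bv i j := fun i j => norm_nonneg _
  -- the steps of `u` inside the box are rotated edge values
  have hrow : ∀ j ∈ range N₁, ∀ i ∈ range (N₀ - 1), ‖u (i + 1) j - u i j‖ = A i j := by
    intro j hj i hi
    rw [mem_range] at hi hj
    have hs := hint i j (by omega) hj
    simp only [hu, hA]
    rw [site_succ_fst, potential_spoke hH hs 5]
  have hcol : ∀ i ∈ range N₀, ∀ j ∈ range (N₁ - 1), ‖u i (j + 1) - u i j‖ = Bv i j := by
    intro i hi j hj
    rw [mem_range] at hi hj
    have hs := hint i j hi (by omega)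
    simp only [hu, hB]
    rw [site_succ_snd, potential_spoke hH hs 0]
  have h1 : ∑ j ∈ range N₁, ∑ i ∈ range (N₀ - 1), ‖u (i + 1) j - u i j‖ ≤
      ∑ i ∈ range N₀, ∑ j ∈ range N₁, A i j :=
    calc ∑ j ∈ range N₁, ∑ i ∈ range (N₀ - 1), ‖u (i + 1) j - u i j‖
        = ∑ j ∈ range N₁, ∑ i ∈ range (N₀ - 1), A i j :=
          sum_congr rfl fun j hj => sum_congr rfl fun i hi => hrow j hj i hi
      _ = ∑ i ∈ range (N₀ - 1), ∑ j ∈ range N₁, A i j := sum_comm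
      _ ≤ ∑ i ∈ range N₀, ∑ j ∈ range N₁, A i j :=
          sum_le_sum_of_subset_of_nonneg (range_subset_range.2 (Nat.sub_le N₀ 1))
            fun i _ _ => sum_nonneg fun j _ => hA0 i j
  have h2 : ∑ i ∈ range N₀, ∑ j ∈ range (N₁ - 1), ‖u i (j + 1) - u i j‖ ≤
      ∑ i ∈ range N₀, ∑ j ∈ range N₁, Bv i j :=
    calc ∑ i ∈ range N₀, ∑ j ∈ range (N₁ - 1), ‖u i (j + 1) - u i j‖
        = ∑ i ∈ range N₀, ∑ j ∈ range (N₁ - 1), Bv i j :=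
          sum_congr rfl fun i hi => sum_congr rfl fun j hj => hcol i hi j hj
      _ ≤ ∑ i ∈ range N₀, ∑ j ∈ range N₁, Bv i j :=
          sum_le_sum fun i _ => sum_le_sum_of_subset_of_nonneg (range_subset_range.2 (Nat.sub_le N₁ 1))
            fun j _ _ => hB0 i j
  have hmax0 : (N₀ : ℝ) ≤ ((max N₀ N₁ : ℕ) : ℝ) := by exact_mod_cast le_max_left N₀ N₁
  have hmax1 : (N₁ : ℝ) ≤ ((max N₀ N₁ : ℕ) : ℝ) := by exact_mod_cast le_max_right N₀ N₁
  have hSA : 0 ≤ ∑ i ∈ range N₀, ∑ j ∈ range N₁, A i j :=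
    sum_nonneg fun i _ => sum_nonneg fun j _ => hA0 i j
  have hSB : 0 ≤ ∑ i ∈ range N₀, ∑ j ∈ range N₁, Bv i j :=
    sum_nonneg fun i _ => sum_nonneg fun j _ => hB0 i j
  have hsum : ∑ i ∈ range N₀, ∑ j ∈ range N₁, (A i j + Bv i j) =
      ∑ i ∈ range N₀, ∑ j ∈ range N₁, A i j + ∑ i ∈ range N₀, ∑ j ∈ range N₁, Bv i j := by
    simp only [sum_add_distrib]
  calc ∑ i ∈ range N₀, ∑ j ∈ range N₁, ∑ i' ∈ range N₀, ∑ j' ∈ range N₁, ‖u i j - u i' j'‖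
      ≤ ((N₀ * N₁ : ℕ) : ℝ) *
          (N₀ * ∑ j ∈ range N₁, ∑ i ∈ range (N₀ - 1), ‖u (i + 1) j - u i j‖ +
            N₁ * ∑ i ∈ range N₀, ∑ j ∈ range (N₁ - 1), ‖u i (j + 1) - u i j‖) :=
        box_poincare_pairs u N₀ N₁
    _ ≤ ((N₀ * N₁ : ℕ) : ℝ) *
          (((max N₀ N₁ : ℕ) : ℝ) * ∑ i ∈ range N₀, ∑ j ∈ range N₁, A i j +
            ((max N₀ N₁ : ℕ) : ℝ) * ∑ i ∈ range N₀, ∑ j ∈ range N₁, Bv i j) := by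
        refine mul_le_mul_of_nonneg_left (add_le_add ?_ ?_) (Nat.cast_nonneg _)
        · exact mul_le_mul hmax0 h1 (sum_nonneg fun j _ => sum_nonneg fun i _ => norm_nonneg _)
            ((Nat.cast_nonneg _).trans hmax0)
        · exact mul_le_mul hmax1 h2 (sum_nonneg fun i _ => sum_nonneg fun j _ => norm_nonneg _)
            ((Nat.cast_nonneg _).trans hmax1)
    _ = 1 * (((N₀ * N₁ : ℕ) : ℝ) * ((max N₀ N₁ : ℕ) : ℝ) *
          ∑ i ∈ range N₀, ∑ j ∈ range N₁, (A i j + Bv i j)) := by rw [hsum]; ring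
    _ ≤ 2 * (((N₀ * N₁ : ℕ) : ℝ) * ((max N₀ N₁ : ℕ) : ℝ) *
          ∑ i ∈ range N₀, ∑ j ∈ range N₁, (A i j + Bv i j)) := by
        refine mul_le_mul_of_nonneg_right (by norm_num) ?_
        rw [hsum]
        have : 0 ≤ ((max N₀ N₁ : ℕ) : ℝ) := Nat.cast_nonneg _
        positivity
    _ = _ := by ring

/-- **Registered sub-goal `pickEngine_poincare`** (crux item stmt-CriticalPhenomena-14004, line
`pick-half-plane`, engine input S3): the discrete Poincaré inequality for a potential of `F dz` on a
box of interior sites, in registry form (one `∀`-term; see `potential_box_poincare`). -/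
theorem pickEngine_poincare : ∀ (Λ : Finset HexVertex) (a : Sym2 HexVertex) (H : Site 2 → ℂ), IsPotential Λ a H → ∀ (x₀ y₀ : ℤ) (N₀ N₁ : ℕ), (∀ i j : ℕ, i < N₀ → j < N₁ → IsInteriorSite Λ ![x₀ + (i : ℤ), y₀ + (j : ℤ)]) → ∑ i ∈ Finset.range N₀, ∑ j ∈ Finset.range N₁, ∑ i' ∈ Finset.range N₀, ∑ j' ∈ Finset.range N₁, ‖H ![x₀ + (i : ℤ), y₀ + (j : ℤ)] - H ![x₀ + (i' : ℤ), y₀ + (j' : ℤ)]‖ ≤ 2 * ((N₀ * N₁ : ℕ) : ℝ) * ((max N₀ N₁ : ℕ) : ℝ) * ∑ i ∈ Finset.range N₀, ∑ j ∈ Finset.range N₁, (‖edgeValue (hexParafermionicObservable Λ a hexCriticalFugacity (5 / 8)) ![x₀ + (i : ℤ), y₀ + (j : ℤ)] 5‖ + ‖edgeValue (hexParafermionicObservable Λ a hexCriticalFugacity (5 / 8)) ![x₀ + (i : ℤ), y₀ + (j : ℤ)] 0‖) :=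
  fun _ _ _ hH x₀ y₀ N₀ N₁ hint => potential_box_poincare hH x₀ y₀ N₀ N₁ hint

end Summit.CriticalPhenomena.SAWScalingLimit.Theorems.PickHalfPlane.LocalL1

end
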